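import Summits.HubbardSuperconductivity.HubbardSuperconductivity.Theorems.InfiniteVolumeFirstCoarseTightnessMesoCeiling

/-!
# Crux `NoInfraredPileUp` (stmt-HubbardSuperconductivity-18534) — the window pair weight is `O(U^{1/4}) L²`
# at EVERY coupling `U ≤ 1` (explicit rate of the coarse-tightness calibration)

The coarse-tightness programme (PLAN-coarse-tightness.md; landed `CoarseTightness.stub_coarseMesoCeiling`,
p153059, and `coarseTightness_of_mesoCeiling`, p152080) proved the crux in the COARSE quantifier order
`∀ η ∃ U_η ∀ U < U_η` (`coarseTightness_holds`). The same mesoscopic ceiling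
`𝓜_R(ψ) ≤ c₁/R + c₂√τ + (c₃/√τ)√(U + c₄/R)` gives, at the scale `τ = √U`, an EXPLICIT RATE at every
fixed coupling: for every `U ∈ (0,1]`, every filling prescription `N_L = 2⌊(1-δ)L²/2⌋` (any real `δ`)
and every admissible ground-state family there are `ε > 0`, `L₀` with

  `Σ_{m ≠ 0, |q_m| ≤ ε} S_{ψ_L}(m) ≤ 2(1 + c₂ + √2·c₃) · U^{1/4} · L²`   for all even `L ≥ L₀`

(`windowSum_le_quarticRoot_of_mesoCeiling`; with the landed constants `c₂ = 65536`, `c₃ = 128`: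
`≤ 131500 · U^{1/4} · L²`, `stub_windowSumQuarticRate`). Choice of scales: `R` with `c₁/R ≤ U^{1/4}` and
`c₄/R ≤ U`, so `(c₃/U^{1/4})√(U + c₄/R) ≤ √2 c₃ U^{1/4}`; then `ε = 1/(8R)`, `L₀ = 2R+2` and the landed
window reduction `windowSum_le_two_mul_mesoOrder` (`window ≤ 2L²𝓜_R`).

Reading for the crux: together with the unconditional atom ceiling `atomCeiling_holds`
(`atom ≤ 65664·U^{1/4}`), ALL condensate-scale `d`-wave pair weight near zero momentum — the zero-mode
atom AND the sliding / generalised-condensate window mass that `NoInfraredPileUp` forbids — is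
`O(U^{1/4})` per site in every weak-coupling torus ground state; the crux is exactly the statement that
the window part is not merely `O(U^{1/4})L²` but `o(1)·L²` as `ε → 0` at FIXED `U` (the regime
`η < C·U^{1/4}`, behind the twist wall). Elementary composition of landed theorems; no definition and
no named fact is introduced. Source of the mechanism: T. Kennedy, E. H. Lieb, B. S. Shastry, PRL 61
(1988) 2582 (kinetic-energy bounds on pair order).
-/

noncomputable section

-- the mandated namespace `Summit.<Summit>.<Problem>.Theorems` repeats `HubbardSuperconductivity`
-- (single-problem summit, D-0017), which the `dupNamespace` linter flags on every declaration
set_option linter.dupNamespace false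

namespace Summit.HubbardSuperconductivity.HubbardSuperconductivity.Theorems.CoarseTightness

open Literature.MathematicalPhysics.QuantumLattice Literature.Probability.LatticeModels Matrix Finset
  Filter
open scoped ComplexConjugate ComplexOrder Topology

/-- **Window pair weight `≤ 2(1 + c₂ + √2 c₃)·U^{1/4}·L²` from a mesoscopic pair-order ceiling.**
If the ground states of the repulsive Hubbard torus obey `𝓜_R(ψ) ≤ c₁/R + c₂√τ + (c₃/√τ)√(U + c₄/R)`
(hypothesis `hM`; `c_i ≥ 0`), then for every real `δ`, every `U ∈ (0,1]` and every admissible family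
(`N_L = 2⌊(1-δ)L²/2⌋`, `ψ_L` a normalised `(N_L,0)`-sector ground state at every even `L`) there are
`ε > 0`, `L₀` with `Σ_{m≠0,|q_m|≤ε} S_{ψ_L}(m) ≤ 2(1 + c₂ + √2·c₃)·U^{1/4}·L²` for all even `L ≥ L₀`:
take `τ = √U`, `R` with `c₁/R ≤ U^{1/4}` and `c₄/R ≤ U`, `ε = 1/(8R)`, `L₀ = 2R + 2`, and the landed
window reduction `windowSum_le_two_mul_mesoOrder`. Kennedy–Lieb–Shastry, PRL 61 (1988) 2582. [folklore] -/
theorem windowSum_le_quarticRoot_of_mesoCeiling {c₁ c₂ c₃ c₄ : ℝ} (h₁ : 0 ≤ c₁) (h₂ : 0 ≤ c₂)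
    (h₃ : 0 ≤ c₃) (h₄ : 0 ≤ c₄)
    (hM : ∀ τ ∈ Set.Ioc (0:ℝ) 1, ∀ R : ℕ, 1 ≤ R → ∀ (L : ℕ) [NeZero L], 2 * R + 2 ≤ L →
      ∀ U ∈ Set.Icc (0:ℝ) 1, ∀ (n : ℕ) (φ : Fock (Orb (FermionTorus 2 L))), star φ ⬝ᵥ φ = 1 →
        IsGroundStateInSector (hubbardTorus 2 L 1 U) (2 * n) 0 φ →
          (∑ a : TorusSite 2 L, (star ((∑ u : Fin 2 → Fin R,
              localPair dWaveFormFactor L (a + fun i => ((u i : ℕ) : ZMod L))) *ᵥ φ) ⬝ᵥ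
            ((∑ u : Fin 2 → Fin R,
              localPair dWaveFormFactor L (a + fun i => ((u i : ℕ) : ZMod L))) *ᵥ φ)).re) /
            ((L : ℝ) ^ 2 * (R : ℝ) ^ 4) ≤
          c₁ / R + c₂ * Real.sqrt τ + c₃ / Real.sqrt τ * Real.sqrt (U + c₄ / R)) :
    ∀ (δ U : ℝ), U ∈ Set.Ioc (0:ℝ) 1 →
      ∀ (N : ℕ → ℕ) (ψ : ∀ L, Fock (Orb (FermionTorus 2 L))),
        (∀ L, Even L → N L = 2 * ⌊(1 - δ) * (L : ℝ) ^ 2 / 2⌋₊ ∧ star (ψ L) ⬝ᵥ ψ L = 1 ∧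
          IsGroundStateInSector (hubbardTorus 2 L 1 U) (N L) 0 (ψ L)) →
        ∃ ε : ℝ, 0 < ε ∧ ∃ L₀ : ℕ, ∀ (L : ℕ) [NeZero L], Even L → L₀ ≤ L →
          (∑ m : Fin 2 → ZMod L, if m ≠ 0 ∧ momentumNormSq L m ≤ ε ^ 2 then
              pairStructureFactor dWaveFormFactor L (ψ L) m else 0) ≤
            2 * (1 + c₂ + Real.sqrt 2 * c₃) * Real.sqrt (Real.sqrt U) * (L : ℝ) ^ 2 := by
  intro δ U hU N ψ hadm
  have hU0 : 0 < U := hU.1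
  have hU1 : U ≤ 1 := hU.2
  -- the scales: `τ = √U`, `t = U^{1/4} = √τ`
  set τ : ℝ := Real.sqrt U with hτ
  have hτ0 : 0 < τ := Real.sqrt_pos.2 hU0
  have hτ1 : τ ≤ 1 := by rw [hτ, Real.sqrt_le_one]; exact hU1
  set t : ℝ := Real.sqrt τ with ht
  have ht0 : 0 < t := Real.sqrt_pos.2 hτ0
  have htt : t ^ 2 = τ := Real.sq_sqrt hτ0.le
  have hττ : τ ^ 2 = U := Real.sq_sqrt hU0.le
  -- `R`: `c₁/R ≤ t` and `c₄/R ≤ U`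
  obtain ⟨R₁, hR₁, hR₁'⟩ := exists_nat_div_le h₁ ht0
  obtain ⟨R₂, hR₂, hR₂'⟩ := exists_nat_div_le h₄ hU0
  set R : ℕ := max R₁ R₂ with hR
  have hR1 : 1 ≤ R := le_max_of_le_left hR₁
  have hRpos : (0:ℝ) < R := by exact_mod_cast hR1
  have hc₁ : c₁ / R ≤ t := by
    refine le_trans (div_le_div_of_nonneg_left h₁ (by exact_mod_cast hR₁) ?_) hR₁'
    exact_mod_cast le_max_left R₁ R₂
  have hc₄ : c₄ / R ≤ U := by
    refine le_trans (div_le_div_of_nonneg_left h₄ (by exact_mod_cast hR₂) ?_) hR₂'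
    exact_mod_cast le_max_right R₁ R₂
  -- the total ceiling is `≤ (1 + c₂ + √2 c₃) t`
  have hΘ : c₁ / R + c₂ * Real.sqrt τ + c₃ / Real.sqrt τ * Real.sqrt (U + c₄ / R) ≤
      (1 + c₂ + Real.sqrt 2 * c₃) * t := by
    rw [← ht]
    -- `√(U + c₄/R) ≤ √(2U) = √2 · τ = √2 · t²`
    have hsum : U + c₄ / R ≤ 2 * U := by linarith
    have hsq : Real.sqrt (U + c₄ / R) ≤ Real.sqrt 2 * t ^ 2 := by
      calc Real.sqrt (U + c₄ / R) ≤ Real.sqrt (2 * U) := Real.sqrt_le_sqrt hsum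
        _ = Real.sqrt 2 * τ := by rw [Real.sqrt_mul (by norm_num : (0:ℝ) ≤ 2), hτ]
        _ = Real.sqrt 2 * t ^ 2 := by rw [htt]
    have h3 : c₃ / t * Real.sqrt (U + c₄ / R) ≤ Real.sqrt 2 * c₃ * t := by
      calc c₃ / t * Real.sqrt (U + c₄ / R) ≤ c₃ / t * (Real.sqrt 2 * t ^ 2) :=
            mul_le_mul_of_nonneg_left hsq (div_nonneg h₃ ht0.le)
        _ = Real.sqrt 2 * c₃ * t := by field_simp
    nlinarith [hc₁, h3, mul_nonneg h₂ ht0.le]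
  -- the window: `ε = 1/(8R)`, `L₀ = 2R + 2`
  refine ⟨1 / (8 * R), by positivity, 2 * R + 2, fun L _ hE hL => ?_⟩
  obtain ⟨n, rfl⟩ : ∃ n, L = n + 1 := ⟨L - 1, by omega⟩
  obtain ⟨hN, hunit, hGS⟩ := hadm (n + 1) hE
  rw [hN] at hGS
  have hmeso := hM τ ⟨hτ0, hτ1⟩ R hR1 (n + 1) hL U ⟨hU0.le, hU1⟩ _ (ψ (n + 1)) hunit hGS
  set Mtot := ∑ a : TorusSite 2 (n + 1), (star ((∑ u : Fin 2 → Fin R,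
      localPair dWaveFormFactor (n + 1) (a + fun i => ((u i : ℕ) : ZMod (n + 1)))) *ᵥ ψ (n + 1)) ⬝ᵥ
    ((∑ u : Fin 2 → Fin R,
      localPair dWaveFormFactor (n + 1) (a + fun i => ((u i : ℕ) : ZMod (n + 1)))) *ᵥ
        ψ (n + 1))).re with hMtot
  have hwin := windowSum_le_two_mul_mesoOrder ψ n R (by exact_mod_cast hR1) (ε := 1 / (8 * R))
    (by positivity) (le_of_eq (by field_simp))
  -- `2 Mtot / R⁴ = 2 L² · (Mtot / (L² R⁴)) ≤ 2 L² · (1 + c₂ + √2 c₃) t`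
  set K : ℝ := (1 + c₂ + Real.sqrt 2 * c₃) * t with hK
  have hK0 : 0 ≤ K := by positivity
  have hkey : 2 * Mtot / (R : ℝ) ^ 4 ≤ 2 * (1 + c₂ + Real.sqrt 2 * c₃) * t * ((n + 1 : ℕ) : ℝ) ^ 2 := by
    have h1 : Mtot / (((n + 1 : ℕ) : ℝ) ^ 2 * (R : ℝ) ^ 4) ≤ K := hmeso.trans hΘ
    have h1' : Mtot ≤ K * (((n + 1 : ℕ) : ℝ) ^ 2 * (R : ℝ) ^ 4) :=
      (div_le_iff₀ (by positivity)).1 h1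
    rw [div_le_iff₀ (by positivity)]
    have hpos : 0 ≤ K * ((n + 1 : ℕ) : ℝ) ^ 2 * (R : ℝ) ^ 4 := by positivity
    rw [hK] at h1'
    nlinarith
  exact hwin.trans hkey

/-- **Registered stub `stub_windowSumQuarticRate` (crux stmt-HubbardSuperconductivity-18534): the
small-momentum window of the `d`-wave pair structure factor of every admissible ground-state family of
the repulsive Hubbard torus at coupling `U ∈ (0,1]` is eventually `≤ 131500 · U^{1/4} · L²`** — the
explicit-rate form of the landed coarse tightness (`coarseTightness_holds`), from the landed mesoscopic
ceiling `stub_coarseMesoCeiling` (`c₂ = 65536`, `c₃ = 128`; `2(1 + 65536 + 128√2) ≤ 131500`).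
So the sliding / generalised-condensate mass that `NoInfraredPileUp` forbids is unconditionally
`O(U^{1/4})` per site. Kennedy–Lieb–Shastry, PRL 61 (1988) 2582. [folklore] -/
theorem stub_windowSumQuarticRate : ∀ (δ U : ℝ), U ∈ Set.Ioc (0:ℝ) 1 → ∀ (N : ℕ → ℕ) (ψ : ∀ L, Fock (Orb (FermionTorus 2 L))), (∀ L, Even L → N L = 2 * ⌊(1 - δ) * (L : ℝ) ^ 2 / 2⌋₊ ∧ star (ψ L) ⬝ᵥ ψ L = 1 ∧ IsGroundStateInSector (hubbardTorus 2 L 1 U) (N L) 0 (ψ L)) → ∃ ε : ℝ, 0 < ε ∧ ∃ L₀ : ℕ, ∀ (L : ℕ) [NeZero L], Even L → L₀ ≤ L → (∑ m : Fin 2 → ZMod L, if m ≠ 0 ∧ momentumNormSq L m ≤ ε ^ 2 then pairStructureFactor dWaveFormFactor L (ψ L) m else 0) ≤ 131500 * Real.sqrt (Real.sqrt U) * (L : ℝ) ^ 2 := by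
  intro δ U hU N ψ hadm
  obtain ⟨ε, hε, L₀, h⟩ := windowSum_le_quarticRoot_of_mesoCeiling (by norm_num) (by norm_num)
    (by norm_num) (by positivity) stub_coarseMesoCeiling δ U hU N ψ hadm
  refine ⟨ε, hε, L₀, fun L _ hE hL => (h L hE hL).trans ?_⟩
  have ht : 0 ≤ Real.sqrt (Real.sqrt U) := Real.sqrt_nonneg _
  have hs2 : Real.sqrt 2 ≤ 3 / 2 := by
    rw [Real.sqrt_le_left (by norm_num)]
    norm_num
  have hc : 2 * (1 + 65536 + Real.sqrt 2 * 128) ≤ (131500 : ℝ) := by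
    nlinarith [hs2]
  have hL2 : 0 ≤ ((L : ℕ) : ℝ) ^ 2 := sq_nonneg _
  exact mul_le_mul_of_nonneg_right (mul_le_mul_of_nonneg_right hc ht) hL2

end Summit.HubbardSuperconductivity.HubbardSuperconductivity.Theorems.CoarseTightness

end
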